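import Literature.NumberTheory.EllipticCurves.KummerHomsFinite
import Mathlib.FieldTheory.SeparableClosure
import Mathlib.FieldTheory.PurelyInseparable.Basic
import HarnessLib

/-!
# Kummer generators of characters of `Aut(Ω/k)` for a normal, possibly inseparable, `Ω/k`
# (Silverman AEC VIII.§1–§2, proof of Prop. VIII.1.6; Lang, *FDG*, Ch. 6 Thm. 1.2)

Decomposition file (D-0014/D-0026, provefact seat on
`Literature.NumberTheory.EllipticCurves.FunctionField.finite_shaPrimeToChar_torsionBy`, statement
file `FunctionField`, bsd.S33). The tree's Kummer-theory step
`Literature.NumberTheory.EllipticCurves.exists_kummer_generator` (`KummerHomsFinite`: every additive map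
`f : Gal(Ω/k) → ℤ/dℤ` vanishing on `Gal(Ω/E)` for a finite `E/k` is `σ ↦ log_ζ (σ α / α)` for a
`d`-th root `α` of some `a ∈ kˣ`, when `μ_d ⊆ k`) is stated for a **Galois** pair `(k, Ω)`; it is
consumed with `Ω = K̄`, which is Galois over `k` only in characteristic `0`. Over a global function
field `F` of characteristic `p` the algebraic closure `F̄` is normal but not separable over the
finite extensions `k` of `F`, and `Aut(F̄/k) = Gal(F^{sep}/k)`. This file proves the same
statement for a **normal** pair `(k, Ω)` in any characteristic
(`exists_kummer_generator_of_normal`), which is what the finiteness of `H¹(G_F, M; S)`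
(Silverman X.4.3 / Milne ADT I.4.15) over function fields needs:

* `mem_fixingSubgroup_of_mem_fixingSubgroup_inf_separableClosure`: an automorphism of `Ω/k`
  fixing the separable part `E ∩ k^{sep}` of a subextension `E` fixes `E` (`E` is purely
  inseparable over its separable part: `x ^ (q ^ n)` is separable for some `n`, and
  `(σ x - x) ^ (q ^ n) = σ (x ^ (q ^ n)) - x ^ (q ^ n) = 0`);
* hence `f` also vanishes on `Gal(Ω/E_s)` for the finite *separable* `E_s = E ∩ k^{sep}`, whose
  normal closure `L` in `Ω` is finite **Galois** over `k` (normal inside the normal `Ω`,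
  separable as a compositum of conjugates of `E_s`, Mathlib `IntermediateField.isSeparable_iSup`
  through `le_separableClosure_iff`); `f` descends to `Gal(L/k)` (restriction is surjective for
  normal `Ω`, `AlgEquiv.restrictNormalHom_surjective`, with kernel `Gal(Ω/L)`), and Hilbert 90 in
  Noether's form (`groupCohomology.isMulCoboundary₁_of_isMulCocycle₁_of_aut_to_units`) applied to
  the cocycle `σ ↦ ζ^{f σ}` produces `β ∈ Lˣ` with `σ β = ζ^{f σ} β`; `a = β^d ∈ k`.

The injectivity `kummer_generator_injective` of `KummerHomsFinite` is already stated without the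
Galois hypothesis and is reused as is.

## References

* [SilvermanAEC2009] J. H. Silverman, *The Arithmetic of Elliptic Curves*, 2nd ed., VIII.§1–§2
  (Kummer pairing), proof of Prop. VIII.1.6 ("by Kummer theory").
* [Lang1983] S. Lang, *Fundamentals of Diophantine Geometry*, Ch. 6 §1, Thm. 1.2 (Kummer theory,
  "Galois theory (Hilbert's theorem 90)"), p. 123 of the held copy.
* J. S. Milne, *Fields and Galois Theory*, Ch. 7 (`Aut(F̄/F) = Gal(F^{sep}/F)`).

## Mathlib reuse

`separableClosure`, `separableClosure.isPurelyInseparable`, `isPurelyInseparable_iff_pow_mem`,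
`sub_pow_expChar_pow`, `le_separableClosure_iff`, `normalClosure_le_iff`,
`map_mem_separableClosure_iff`, `normalClosure.normal`, `normalClosure.is_finiteDimensional`,
`AlgEquiv.restrictNormalHom(_surjective)`, `IntermediateField.restrictNormalHom_ker`,
`groupCohomology.isMulCoboundary₁_of_isMulCocycle₁_of_aut_to_units`, `IsGalois.mem_bot_iff_fixed`;
tree: `map_inv_eq_neg_of_map_mul` (`KummerHomsFinite`).
-/

noncomputable section

open scoped Pointwise IntermediateField

open IntermediateField

universe u

namespace Literature.NumberTheory.EllipticCurves

/-! ## Fixing the separable part fixes the field -/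

section SeparablePart

variable {k : Type u} [Field k] {Ω : Type u} [Field Ω] [Algebra k Ω]

/-- **An automorphism fixing the separable part of `E` fixes `E`.** For a subextension `E` of an
algebraic `Ω/k`, every `σ ∈ Aut(Ω/k)` fixing `E ∩ k^{sep}` (`k^{sep} = separableClosure k Ω`)
pointwise fixes `E` pointwise: `E` is purely inseparable over its separable closure
(`separableClosure.isPurelyInseparable`), so each `x ∈ E` has a separable power `x ^ (q ^ n)`
(`q` the exponential characteristic), and `(σ x - x) ^ (q ^ n) = σ (x ^ (q ^ n)) - x ^ (q ^ n) = 0`.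
Milne, *Fields and Galois Theory*, Ch. 7 (`Aut(Ω/k)` only sees the separable closure).
[folklore] -/
theorem mem_fixingSubgroup_of_mem_fixingSubgroup_inf_separableClosure [Algebra.IsAlgebraic k Ω]
    (E : IntermediateField k Ω) {σ : Ω ≃ₐ[k] Ω}
    (hσ : σ ∈ (E ⊓ separableClosure k Ω).fixingSubgroup) : σ ∈ E.fixingSubgroup := by
  rw [IntermediateField.mem_fixingSubgroup_iff] at hσ ⊢
  intro x hx
  let q := ringExpChar k
  haveI : ExpChar Ω q := expChar_of_injective_ringHom (algebraMap k Ω).injective q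
  haveI : Algebra.IsAlgebraic k E :=
    Algebra.IsAlgebraic.of_injective E.val E.val.toRingHom.injective
  obtain ⟨n, y, hy⟩ :=
    (isPurelyInseparable_iff_pow_mem (separableClosure k E) q).mp inferInstance (⟨x, hx⟩ : E)
  have hsep : IsSeparable k ((y : E) : Ω) := by
    have h1 : IsSeparable k (y : E) := mem_separableClosure_iff.mp y.2
    exact (isSeparable_map_iff E.val E.val.toRingHom.injective).mpr h1
  have hxq : x ^ q ^ n = ((y : E) : Ω) := by
    have := congrArg (fun z : E => (z : Ω)) hy
    simpa using this.symm
  have hmem : x ^ q ^ n ∈ E ⊓ separableClosure k Ω := by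
    refine IntermediateField.mem_inf.mpr ⟨pow_mem hx _, ?_⟩
    rw [mem_separableClosure_iff, hxq]
    exact hsep
  have h := hσ _ hmem
  have h0 : (σ x - x) ^ q ^ n = 0 := by
    rw [sub_pow_expChar_pow, ← map_pow, h, sub_self]
  exact sub_eq_zero.mp ((pow_eq_zero_iff (pow_pos (expChar_pos Ω q) n).ne').mp h0)

/-- The separable part `E ∩ k^{sep}` of a finite subextension is finite and separable over `k`,
and `Gal(Ω/(E ∩ k^{sep})) ⊆ Gal(Ω/E)` pointwise; so a function vanishing on `Gal(Ω/E)` for some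
finite `E` vanishes on `Gal(Ω/E')` for some finite *separable* `E'`. [folklore] -/
theorem exists_finiteDimensional_isSeparable_of_vanishing [Algebra.IsAlgebraic k Ω] {M : Type*}
    [Zero M] {f : (Ω ≃ₐ[k] Ω) → M}
    (hE : ∃ E : IntermediateField k Ω, FiniteDimensional k E ∧ ∀ σ ∈ E.fixingSubgroup, f σ = 0) :
    ∃ E : IntermediateField k Ω, FiniteDimensional k E ∧ Algebra.IsSeparable k E ∧
      ∀ σ ∈ E.fixingSubgroup, f σ = 0 := by
  obtain ⟨E, hEfin, hEker⟩ := hE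
  haveI := hEfin
  refine ⟨E ⊓ separableClosure k Ω,
    Module.Finite.of_injective
      (IntermediateField.inclusion (inf_le_left : E ⊓ separableClosure k Ω ≤ E)).toLinearMap
      (IntermediateField.inclusion_injective (inf_le_left : E ⊓ separableClosure k Ω ≤ E)),
    (le_separableClosure_iff k Ω _).mp inf_le_right, fun σ hσ => ?_⟩
  exact hEker σ (mem_fixingSubgroup_of_mem_fixingSubgroup_inf_separableClosure E hσ)

end SeparablePart

/-! ## Kummer generators (Hilbert 90) for a normal pair -/

section Kummer

variable {k : Type u} [Field k] {Ω : Type u} [Field Ω] [Algebra k Ω] [Normal k Ω]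

/-- **Kummer generators (Hilbert 90), normal pair.** Let `k ∋ ζ` with `ζ` a primitive `d`-th
root of unity and let `Ω/k` be *normal* (e.g. `Ω = k̄`, any characteristic). Every additive map
`f : Aut(Ω/k) → ℤ/dℤ` that vanishes on `Aut(Ω/E)` for some finite subextension `E/k` (e.g. a
continuous homomorphism) is a Kummer character: there exist `a ∈ kˣ` and `α ∈ Ω` with `α^d = a`
and `σ α = ζ^{f(σ)} α` for all `σ ∈ Aut(Ω/k)`. Proof: `f` vanishes on `Aut(Ω/E_s)` for the
finite separable `E_s = E ∩ k^{sep}` (`exists_finiteDimensional_isSeparable_of_vanishing`); the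
normal closure `L` of `E_s` in `Ω` is finite Galois over `k`; descend `f` to `Gal(L/k)`
(`AlgEquiv.restrictNormalHom` is surjective with kernel `Aut(Ω/L)`), apply Hilbert 90 in
Noether's form to the cocycle `σ ↦ ζ^{f σ} ∈ Lˣ`, and take `a = β^d`. This is the tree's
`exists_kummer_generator` (`KummerHomsFinite`) with `IsGalois k Ω` weakened to `Normal k Ω`.
Silverman, *AEC*, VIII.§1–§2 and proof of Prop. VIII.1.6 ("the main theorem of Kummer
theory"); Lang, *FDG*, Ch. 6 Thm. 1.2.
[cite: SilvermanAEC2009, VIII.1 (proof of Prop. 1.6, Kummer theory step)] -/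
theorem exists_kummer_generator_of_normal {d : ℕ} (hd : 0 < d) {ζ : k} (hζ : IsPrimitiveRoot ζ d)
    (f : (Ω ≃ₐ[k] Ω) → ZMod d) (hf : ∀ σ τ, f (σ * τ) = f σ + f τ)
    (hE : ∃ E : IntermediateField k Ω, FiniteDimensional k E ∧ ∀ σ ∈ E.fixingSubgroup, f σ = 0) :
    ∃ a : k, a ≠ 0 ∧ ∃ α : Ω, α ^ d = algebraMap k Ω a ∧
      ∀ σ : Ω ≃ₐ[k] Ω, σ α = algebraMap k Ω ζ ^ (f σ).val * α := by
  classical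
  haveI : NeZero d := ⟨hd.ne'⟩
  haveI : Algebra.IsAlgebraic k Ω := inferInstance
  obtain ⟨E, hEfin, hEsep, hEker⟩ := exists_finiteDimensional_isSeparable_of_vanishing hE
  haveI := hEfin
  haveI := hEsep
  -- ### a finite Galois `L/k` inside `Ω` with `f = 0` on `Aut(Ω/L)`
  let L : IntermediateField k Ω := normalClosure k E Ω
  haveI : FiniteDimensional k L := normalClosure.is_finiteDimensional k E Ω
  haveI : Normal k L := normalClosure.normal k E Ω
  haveI : Algebra.IsSeparable k L := by
    refine (le_separableClosure_iff k Ω _).mp (normalClosure_le_iff.mpr fun g x hx => ?_)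
    obtain ⟨y, rfl⟩ := hx
    exact (map_mem_separableClosure_iff g).mpr (mem_separableClosure_iff.mpr
      (Algebra.IsSeparable.isSeparable k y))
  haveI : IsGalois k L := ⟨⟩
  have hLker : ∀ σ ∈ L.fixingSubgroup, f σ = 0 := fun σ hσ ↦
    hEker σ (IntermediateField.fixingSubgroup_antitone (IntermediateField.le_normalClosure E) hσ)
  -- ### descend `f` to `G = Gal(L/k)`
  let ρ : (Ω ≃ₐ[k] Ω) →* (L ≃ₐ[k] L) := AlgEquiv.restrictNormalHom L
  have hρ : Function.Surjective ρ := AlgEquiv.restrictNormalHom_surjective Ω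
  have hρker : ∀ σ, ρ σ = 1 → f σ = 0 := by
    intro σ hσ
    apply hLker
    rw [← IntermediateField.restrictNormalHom_ker L]
    exact hσ
  have hfconst : ∀ σ τ, ρ σ = ρ τ → f σ = f τ := by
    intro σ τ hστ
    have h1 : ρ (τ⁻¹ * σ) = 1 := by rw [map_mul, map_inv, hστ, inv_mul_cancel]
    have h2 := hρker _ h1
    rw [hf, map_inv_eq_neg_of_map_mul hf] at h2
    exact (neg_add_eq_zero.mp h2).symm
  let s : (L ≃ₐ[k] L) → (Ω ≃ₐ[k] Ω) := Function.surjInv hρ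
  have hs : ∀ g, ρ (s g) = g := Function.surjInv_eq hρ
  let fL : (L ≃ₐ[k] L) → ZMod d := fun g ↦ f (s g)
  have hfL : ∀ σ, f σ = fL (ρ σ) := fun σ ↦ hfconst σ _ (hs (ρ σ)).symm
  have hfLmul : ∀ g h, fL (g * h) = fL g + fL h := by
    intro g h
    change f (s (g * h)) = f (s g) + f (s h)
    rw [← hf]
    apply hfconst
    rw [map_mul, hs, hs, hs]
  -- ### the cocycle `g ↦ ζ ^ fL g` with values in `Lˣ`
  have hζ0 : algebraMap k L ζ ≠ 0 := by
    rw [map_ne_zero_iff _ (algebraMap k L).injective]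
    exact hζ.ne_zero hd.ne'
  let ζL : Lˣ := Units.mk0 (algebraMap k L ζ) hζ0
  have hζLd : ζL ^ d = 1 := by
    ext
    rw [Units.val_pow_eq_pow_val, Units.val_mk0, ← map_pow, hζ.pow_eq_one, map_one, Units.val_one]
  have hζLmod : ∀ n : ℕ, ζL ^ n = ζL ^ (n % d) := by
    intro n
    conv_lhs => rw [← Nat.div_add_mod n d]
    rw [pow_add, pow_mul, hζLd, one_pow, one_mul]
  have hζLfix : ∀ (g : L ≃ₐ[k] L) (n : ℕ), g • (ζL ^ n) = ζL ^ n := by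
    intro g n
    ext
    rw [AlgEquiv.smul_units_def, Units.coe_map, MonoidHom.coe_coe, Units.val_pow_eq_pow_val,
      Units.val_mk0, ← map_pow, AlgEquiv.commutes]
  let c : (L ≃ₐ[k] L) → Lˣ := fun g ↦ ζL ^ (fL g).val
  have hc : groupCohomology.IsMulCocycle₁ c := by
    intro g h
    change ζL ^ (fL (g * h)).val = g • ζL ^ (fL h).val * ζL ^ (fL g).val
    rw [hζLfix, ← pow_add, hfLmul, ZMod.val_add, ← hζLmod, add_comm]
  -- ### Hilbert 90
  obtain ⟨β, hβ⟩ := groupCohomology.isMulCoboundary₁_of_isMulCocycle₁_of_aut_to_units c hc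
  have hβ' : ∀ g : L ≃ₐ[k] L, g (β : L) = (algebraMap k L ζ) ^ (fL g).val * β := by
    intro g
    have h := hβ g
    rw [div_eq_iff_eq_mul] at h
    have h' := congrArg (fun u : Lˣ ↦ (u : L)) h
    simpa [AlgEquiv.smul_units_def, c, ζL, Units.val_pow_eq_pow_val] using h'
  -- ### `a = β ^ d ∈ k`
  have hβd : ∀ g : L ≃ₐ[k] L, g ((β : L) ^ d) = (β : L) ^ d := by
    intro g
    rw [map_pow, hβ', mul_pow, ← pow_mul, mul_comm (fL g).val d, pow_mul, ← map_pow,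
      hζ.pow_eq_one, map_one, one_pow, one_mul]
  obtain ⟨a, ha⟩ : ((β : L) ^ d : L) ∈ (⊥ : IntermediateField k L) :=
    (IsGalois.mem_bot_iff_fixed _).mpr hβd
  change algebraMap k L a = (β : L) ^ d at ha
  refine ⟨a, ?_, ((β : L) : Ω), ?_, ?_⟩
  · rintro rfl
    rw [map_zero, eq_comm] at ha
    exact β.ne_zero (eq_zero_of_pow_eq_zero ha)
  · rw [IsScalarTower.algebraMap_apply k L Ω, ha, map_pow]
    rfl
  · intro σ
    have h1 : σ ((β : L) : Ω) = ((ρ σ (β : L) : L) : Ω) :=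
      (AlgEquiv.restrictNormal_commutes σ L (β : L)).symm
    rw [h1, hβ', ← hfL σ]
    change algebraMap L Ω ((algebraMap k L ζ) ^ (f σ).val * β) = _
    rw [map_mul, map_pow, ← IsScalarTower.algebraMap_apply]
    rfl

end Kummer



end Literature.NumberTheory.EllipticCurves

end
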